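import Literature.RepresentationTheory.HeisenbergGroup.ImplementerCocycle
import Literature.RepresentationTheory.HeisenbergGroup.SchrodingerPiGeneration
import HarnessLib

/-!
# The class of the implementer cocycle does not depend on the section; the metaplectic class of `Sp(F^ι ⊕ F^ι)`

Topic `RepresentationTheory/HeisenbergGroup`; namespace `Literature.RepresentationTheory.HeisenbergGroup`.

KERNEL throughout; no records. `ImplementerCocycle.lean` attaches to every normalised section `r` of implementers of
a model `ρ` (under uniqueness up to scalars `hU`) a normalised `2`-cocycle `c_r ∈ Z²(Sp(W), kˣ)`
(`ImplementerSection.cocycle`). Here: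
* §1 two sections differ by a normalised `1`-cochain `ν = sectionRatio r r'`: `r(g) = ν(g) · r'(g)`
  ([MoeglinVignerasWaldspurger1987] Chap. 2 II.1: "`M` est unique à un scalaire près");
* §2 **`c_{r'} = c_r.twist ν`** (`ImplementerSection.cocycle_eq_twist`): the two cocycles are cohomologous, so the
  class `[c_r] ∈ H²(Sp(W), kˣ)` is an invariant of the model `ρ` — the class of the extension `S̃p_ψ(W)` of
  [MoeglinVignerasWaldspurger1987] Chap. 2 II.1 (B);
* §3 the rank-`n` Schrödinger model on `𝒮(F^ι)` (`SchrodingerCommutantPi`, `SchrodingerPiGeneration`): sections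
  EXIST (`schrodingerSectionPi`), `𝒮(F^ι) ≠ 0`, and any two sections give cohomologous cocycles
  (`schrodingerCocyclePi_eq_twist`) — the metaplectic class of `Sp(F^ι ⊕ F^ι)` realised by operators on `𝒮(F^ι)`,
  KERNEL and hypothesis-free (the class that [Rangarao1993] Thm 4.1 / [Perrin1981] identify with the Leray class of
  `Weil1964/LocalLerayCocycle.lean`; that identification is NOT made here).

## References

* [MoeglinVignerasWaldspurger1987] C. Mœglin, M.-F. Vignéras, J.-L. Waldspurger, *Correspondances de Howe sur un
  corps p-adique*, LNM 1291 (1987), Chap. 2 II.1.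
-/

set_option autoImplicit false

noncomputable section

namespace Literature.RepresentationTheory.HeisenbergGroup

open Literature.GroupTheory
open Literature.NumberTheory.Automorphic

universe u v u' v'

section General

variable {R : Type u} [CommRing R] [Invertible (2 : R)] {V : Type v} [AddCommGroup V] [Module R V]
  {B : V →ₗ[R] V →ₗ[R] R}
variable {k : Type u'} [Field k] {S : Type v'} [AddCommGroup S] [Module k S]
variable {ρ : Representation k (Heisenberg B) S}

namespace ImplementerSection

variable (r r' : ImplementerSection ρ) (hU : ImplementerUniqueUpToScalar ρ)
include hU

/-! ## §1 Two sections differ by a normalised `1`-cochain -/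

/-- two implementers of the same `g` differ by a unit: `∃ ν, r(g) = ν · r'(g)`. [cite: MoeglinVignerasWaldspurger1987, Chap. 2 II.1 (A)] -/
theorem exists_eq_smul (g : symplecticGroup B) : ∃ ν : kˣ, ∀ f, r g f = (ν : k) • r' g f :=
  hU g (r' g) (r g) (r'.implements g) (r.implements g)

/-- **the ratio `ν = r / r'` of two sections**: `r(g) f = ν(g) • r'(g) f`. [cite: MoeglinVignerasWaldspurger1987, Chap. 2 II.1 (A)] -/
def sectionRatio (g : symplecticGroup B) : kˣ :=
  Classical.choose (exists_eq_smul r r' hU g)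

/-- `r(g) f = ν(g) • r'(g) f`. [cite: MoeglinVignerasWaldspurger1987, Chap. 2 II.1 (A)] -/
theorem apply_eq_sectionRatio_smul (g : symplecticGroup B) (f : S) :
    r g f = (sectionRatio r r' hU g : k) • r' g f :=
  Classical.choose_spec (exists_eq_smul r r' hU g) f

variable [Nontrivial S]

/-- the ratio is unique (`S ≠ 0`). [cite: MoeglinVignerasWaldspurger1987, Chap. 2 II.1 (A)] -/
theorem sectionRatio_unique {g : symplecticGroup B} {ν : kˣ} (hν : ∀ f, r g f = (ν : k) • r' g f) :
    ν = sectionRatio r r' hU g := by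
  obtain ⟨f₀, hf₀⟩ := exists_ne (0 : S)
  have h := hν f₀
  rw [apply_eq_sectionRatio_smul r r' hU] at h
  exact (Units.val_injective (smul_left_injective k (r'.apply_ne_zero hf₀ _) h)).symm

/-- normalisation `ν(1) = 1` (both sections are normalised). [cite: MoeglinVignerasWaldspurger1987, Chap. 2 II.1 (A)] -/
theorem sectionRatio_one : sectionRatio r r' hU 1 = 1 := by
  refine (sectionRatio_unique r r' hU fun f => ?_).symm
  rw [r.map_one, r'.map_one, Units.val_one, one_smul]

/-- `ν_{r,r} = 1`. [cite: MoeglinVignerasWaldspurger1987, Chap. 2 II.1 (A)] -/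
theorem sectionRatio_self (g : symplecticGroup B) : sectionRatio r r hU g = 1 :=
  (sectionRatio_unique r r hU (ν := 1) fun f => by rw [Units.val_one, one_smul]).symm

/-! ## §2 The cocycles of two sections are cohomologous -/

/-- **`c_{r'} = c_r · ∂ν`**: `c_{r'}(g, g') = c_r(g, g') ν(gg') ν(g)⁻¹ ν(g')⁻¹` with `ν = r / r'` — the class of the
implementer cocycle in `H²(Sp(W), kˣ)` does not depend on the section ("`M` est unique à un scalaire près").
[cite: MoeglinVignerasWaldspurger1987, Chap. 2 II.1 (A)–(B)] -/
theorem cocycle_eq_twist : r'.cocycle hU = (r.cocycle hU).twist (sectionRatio r r' hU) (sectionRatio_one r r' hU) := by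
  refine CentralCocycle.ext fun g g' => ?_
  rw [CentralCocycle.twist_apply, cocycle_apply, cocycle_apply]
  obtain ⟨f₀, hf₀⟩ := exists_ne (0 : S)
  set ν := sectionRatio r r' hU with hν
  -- `r(g) r(g') f₀` computed through `r'`
  have hg : (ν g : k) ≠ 0 := (ν g).ne_zero
  have hg' : (ν g' : k) ≠ 0 := (ν g').ne_zero
  have hgg : (ν (g * g') : k) ≠ 0 := (ν (g * g')).ne_zero
  have e1 : r g (r g' f₀) =
      ((ν g : k) * (ν g' : k) * (r'.cocycleFun hU g g' : k) * (ν (g * g') : k)⁻¹) • r (g * g') f₀ := by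
    have h3 : r' (g * g') f₀ = (ν (g * g') : k)⁻¹ • r (g * g') f₀ := by
      rw [apply_eq_sectionRatio_smul r r' hU (g * g'), ← hν, inv_smul_smul₀ hgg]
    rw [apply_eq_sectionRatio_smul r r' hU g', LinearEquiv.map_smul, apply_eq_sectionRatio_smul r r' hU g,
      r'.mul_apply hU g g', smul_smul, smul_smul, h3, smul_smul, ← hν]
    congr 1
    ring
  rw [r.mul_apply hU g g'] at e1
  -- `c = ν g ν g' c' ν(gg')⁻¹`  ⇒  `c' = c ν(gg') (ν g)⁻¹ (ν g')⁻¹`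
  have h := smul_left_injective k (r.apply_ne_zero hf₀ _) e1
  apply Units.val_injective
  simp only [Units.val_mul, Units.val_inv_eq_inv_val] at h ⊢
  rw [h]
  field_simp

/-- in particular the cocycle of a section is determined by the section's VALUES only through `ν`: equal sections
give equal cocycles. [cite: MoeglinVignerasWaldspurger1987, Chap. 2 II.1 (A)] -/
theorem cocycle_eq_of_forall_eq (h : ∀ g f, r g f = r' g f) : r.cocycle hU = r'.cocycle hU := by
  rw [cocycle_eq_twist r r' hU]
  refine CentralCocycle.ext fun g g' => ?_
  have hν : ∀ g, sectionRatio r r' hU g = 1 := fun g =>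
    (sectionRatio_unique r r' hU (ν := 1) fun f => by rw [Units.val_one, one_smul, h]).symm
  rw [CentralCocycle.twist_apply, hν, hν, hν, inv_one, mul_one, mul_one, mul_one]

end ImplementerSection

end General

/-! ## §3 The metaplectic class of `Sp(F^ι ⊕ F^ι)` on `𝒮(F^ι)` -/

section Pi

variable {F : Type*} [Field F] [ValuativeRel F] [TopologicalSpace F] [IsNonarchimedeanLocalField F]
  {ι : Type*} [Fintype ι] [Invertible (2 : F)]
  {ψ : AddChar F Circle} (hl : IsLocallyConstant (⇑ψ : F → Circle))
  (hb : ∀ y : ι → F, Continuous fun u : ι → F => dotProductBilin F F u y)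

omit [Invertible (2 : F)] in
/-- `𝒮(F^ι) ≠ 0`. [cite: WeilBNT1967, Ch. VII §2, Def. 1] -/
instance nontrivial_schwartzBruhat_pi : Nontrivial (SchwartzBruhat (ι → F)) :=
  nontrivial_of_ne _ _ piBallSB_zero_ne_zero

/-- **a normalised section of implementers of the smooth Schrödinger model on `𝒮(F^ι)` exists** (from
`existsImplementer_schrodingerSB_pi`). [cite: MoeglinVignerasWaldspurger1987, Chap. 2 II.1 (A)] -/
def schrodingerSectionPi [DecidableEq ι] (hψ : ψ.IsContinuousNontrivial) :
    ImplementerSection (schrodingerSB (dotProductBilin F F (m := ι)) ψ hl hb) :=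
  ImplementerSection.ofExists _ (existsImplementer_schrodingerSB_pi hl hb hψ)

/-- **the cocycle of a section of the Schrödinger model on `𝒮(F^ι)`**: `r(g) r(g') = c_r(g, g') r(gg')`, a normalised
central `2`-cocycle `Sp(F^ι ⊕ F^ι) → ℂˣ` (uniqueness up to scalars is the theorem
`implementerUniqueUpToScalar_schrodingerSB_pi`). [cite: MoeglinVignerasWaldspurger1987, Chap. 2 II.1 (B)] -/
def schrodingerCocyclePi (hψ : ψ.IsContinuousNontrivial)
    (r : ImplementerSection (schrodingerSB (dotProductBilin F F (m := ι)) ψ hl hb)) :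
    CentralCocycle (symplecticGroup (polar (dotProductBilin F F (m := ι)))) ℂˣ :=
  r.cocycle (implementerUniqueUpToScalar_schrodingerSB_pi hl hb hψ)

/-- unfolding. [cite: MoeglinVignerasWaldspurger1987, Chap. 2 II.1 (B)] -/
theorem schrodingerCocyclePi_def (hψ : ψ.IsContinuousNontrivial)
    (r : ImplementerSection (schrodingerSB (dotProductBilin F F (m := ι)) ψ hl hb)) :
    schrodingerCocyclePi hl hb hψ r = r.cocycle (implementerUniqueUpToScalar_schrodingerSB_pi hl hb hψ) := rfl

/-- the defining relation `r(g) (r(g') Φ) = c_r(g, g') • r(gg') Φ` on `𝒮(F^ι)`. [cite: MoeglinVignerasWaldspurger1987, Chap. 2 II.1 (B)] -/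
theorem schrodingerSectionPi_mul_apply (hψ : ψ.IsContinuousNontrivial)
    (r : ImplementerSection (schrodingerSB (dotProductBilin F F (m := ι)) ψ hl hb))
    (g g' : symplecticGroup (polar (dotProductBilin F F (m := ι)))) (Φ : SchwartzBruhat (ι → F)) :
    r g (r g' Φ) = ((schrodingerCocyclePi hl hb hψ r g g' : ℂˣ) : ℂ) • r (g * g') Φ :=
  r.mul_apply (implementerUniqueUpToScalar_schrodingerSB_pi hl hb hψ) g g' Φ

/-- **the metaplectic class is well defined**: the cocycles of any two sections of the Schrödinger model on `𝒮(F^ι)`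
are cohomologous, `c_{r'} = c_r.twist (r / r')`. [cite: MoeglinVignerasWaldspurger1987, Chap. 2 II.1 (A)–(B)] -/
theorem schrodingerCocyclePi_eq_twist (hψ : ψ.IsContinuousNontrivial)
    (r r' : ImplementerSection (schrodingerSB (dotProductBilin F F (m := ι)) ψ hl hb)) :
    schrodingerCocyclePi hl hb hψ r' =
      (schrodingerCocyclePi hl hb hψ r).twist
        (ImplementerSection.sectionRatio r r' (implementerUniqueUpToScalar_schrodingerSB_pi hl hb hψ))
        (ImplementerSection.sectionRatio_one r r' _) :=
  ImplementerSection.cocycle_eq_twist r r' _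

/-- **the Weil representation of the twisted product** `Sp(F^ι ⊕ F^ι) ×_{c_r} ℂˣ → End(𝒮(F^ι))`, `(g, a) ↦ a · r(g)`, is a
homomorphism (tree `ImplementerSection.weilOp`), KERNEL in every finite rank. [cite: MoeglinVignerasWaldspurger1987, Chap. 2 II.1 (B)] -/
def schrodingerWeilOpPi (hψ : ψ.IsContinuousNontrivial)
    (r : ImplementerSection (schrodingerSB (dotProductBilin F F (m := ι)) ψ hl hb)) :
    TwistedProduct (schrodingerCocyclePi hl hb hψ r) →* Module.End ℂ (SchwartzBruhat (ι → F)) :=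
  r.weilOp (implementerUniqueUpToScalar_schrodingerSB_pi hl hb hψ)

/-- formula `(g, a) ↦ a • r(g)`. [cite: MoeglinVignerasWaldspurger1987, Chap. 2 II.1 (B)] -/
theorem schrodingerWeilOpPi_apply (hψ : ψ.IsContinuousNontrivial)
    (r : ImplementerSection (schrodingerSB (dotProductBilin F F (m := ι)) ψ hl hb))
    (x : TwistedProduct (schrodingerCocyclePi hl hb hψ r)) (Φ : SchwartzBruhat (ι → F)) :
    schrodingerWeilOpPi hl hb hψ r x Φ = (x.a : ℂ) • r x.g Φ :=
  r.weilOp_apply _ x Φ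

end Pi

end Literature.RepresentationTheory.HeisenbergGroup
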